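import Mathlib
import HarnessLib
import Summits.ValiantsHypothesis.ValiantsHypothesis.Theses.ValuativeGCT
import Literature.Computability.AlgebraicComplexity.OrbitClosureWeights
import Literature.Computability.Complexity.OccurrenceObstructionsIPProofs
import Literature.RingTheory.MvPolynomial.BihomogeneousCoefficients

/-!
# Sketch — crux idea `isobaric-anchors` for `ValuativeGCT.TailFlip` (stmt-ValiantsHypothesis-15687)

First lemmas of the line (crux-ideate, ideator 2, round 1).  Letters: inner size `n`, padding `j`,
`m = n + j`, outer degree `δ`, inner top variable `x_t = X (topMatIdx n)`.

* `IsTopIsobaric n e₀ h` : every monomial of the inner form `h` has `x_t`-exponent `e₀`.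
* `IsobaricTwistScalar` (L1, provable now, S): on an `x_t`-isobaric form the BIP/Kadish–Landsberg
  twist `Δ_j` (coefficient of `x^e` rescaled by `(e_t + j)!/e_t!`, the factor of
  `aeval_formCoeff_paddedForm_liftHWV`) is the SCALAR `((e₀+j)!/e₀!)`; a degree-`δ` form `F` in the
  coefficients therefore satisfies `F(Δ_j h) = ((e₀+j)!/e₀!)^δ · F(h)`.
* `TwistedInheritance` = verbatim the registered siege stub `stub_twistedInheritance` of the parent
  crux (Cruxes/ValuativeFlip/SiegeStubs.lean), provable now.
* `IsobaricInheritance` (L2, the ENGINE): an UNTWISTED nonsingular evaluation matrix of inner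
  highest-weight vectors of weight `μ*` on `x_t`-ISOBARIC inner points `A_l · per_n` certifies
  `D ≤ mult_{(μ♯(n+j))*} ℂ[Δ_{n+j}(X₀₀^j per_n)]` for EVERY padding `j` — the `j`-uniform, twist-free
  form of BLMW Problem 6.10 on the isobaric sublocus (Laplace sections `x_t^{e₀} · Per_{(n-e₀)×n}`).
* `isobaricTwistScalar_holds` : L1 PROVED (isobaric ⇒ twisted coefficient vector = scalar • untwisted; forms scale).
* `isobaricInheritance_of` : L1 → TwistedInheritance → L2, sorry-free (column scaling of a determinant);
  hence `isobaricInheritance_of_twisted` : TwistedInheritance → L2.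
-/

set_option linter.dupNamespace false
set_option maxHeartbeats 800000

namespace Summit.ValiantsHypothesis.ValiantsHypothesis.Cruxes.TailFlip.IsobaricAnchors

open MvPolynomial
open scoped BigOperators Matrix
open Literature.NumberTheory.DiophantineGeometry
open Literature.Computability.AlgebraicComplexity
open Literature.Computability.Complexity

noncomputable section

/-- `h` is `x_t`-isobaric of degree `e₀`: every monomial in its support has exponent `e₀` at the
inner top variable `topMatIdx n`. Examples inside `End · per_n`: `x_t^{e₀} · per_{n-e₀}(M(x'))`
(block-diagonal substitution) and the Laplace sections `e₀! · x_t^{e₀} · Per(R)` with `R` an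
`(n-e₀) × n` matrix of linear forms avoiding `x_t`. [this idea] -/
def IsTopIsobaric (n : ℕ) [NeZero n] (e₀ : ℕ) (h : MvPolynomial (MatIdx n) ℂ) : Prop :=
  ∀ e ∈ h.support, e (topMatIdx n) = e₀

/-- **L1 (twist is scalar on isobaric forms).** For `F` homogeneous of degree `δ` in the coefficient
variables and `h` isobaric of `x_t`-degree `e₀`, the `Δ_j`-twisted evaluation equals
`((e₀+j).descFactorial j)^δ` times the untwisted one. [this idea; BurgisserIkenmeyerPanovaJAMS2019 Lemma 5.2] -/
def IsobaricTwistScalar : Prop :=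
  ∀ (n j δ e₀ : ℕ) [NeZero n] (F : MvPolynomial (DegIdx (MatIdx n) n) ℂ), F.IsHomogeneous δ →
    ∀ h : MvPolynomial (MatIdx n) ℂ, IsTopIsobaric n e₀ h →
      MvPolynomial.aeval (fun e : DegIdx (MatIdx n) n =>
          (((e.1 (topMatIdx n) + j).descFactorial j : ℕ) : ℂ) * MvPolynomial.coeff e.1 h) F =
        ((((e₀ + j).descFactorial j : ℕ) : ℂ) ^ δ) *
          MvPolynomial.aeval (fun e : DegIdx (MatIdx n) n => MvPolynomial.coeff e.1 h) F

/-- **Twisted inheritance** — verbatim the registered siege stub `stub_twistedInheritance` of the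
parent crux `ValuativeFlip` (provable now from `liftHWV_mem_highestWeightSpace`,
`aeval_formCoeff_paddedForm_liftHWV`, `paddedPerFormLex_eq` and the evaluation-rank certificate).
[Cruxes/ValuativeFlip/SiegeStubs.lean; arXiv:1512.03798 Prop. 2.6(b); arXiv:0907.2850 §6.4 Problem 6.10] -/
def TwistedInheritance : Prop :=
  ∀ (n j δ : ℕ) [NeZero n] [NeZero (n + j)] (μ : Nat.Partition (n * δ)), μ.parts.card ≤ n * n →
    ∀ (D : ℕ) (F : Fin D → MvPolynomial (DegIdx (MatIdx n) n) ℂ),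
      (∀ i, F i ∈ highestWeightSpace (coordRep (MatIdx n) ℂ n) (partitionWeightLex n μ)) →
      ∀ (A : Fin D → Matrix (MatIdx n) (MatIdx n) ℂ),
        (Matrix.of fun i l : Fin D => MvPolynomial.aeval
            (fun e : DegIdx (MatIdx n) n =>
              (((e.1 (topMatIdx n) + j).descFactorial j : ℕ) : ℂ) *
                MvPolynomial.coeff e.1 (linSubst (MatIdx n) ℂ (A l) (paddedPerFormLex ℂ n n)))
            (F i)).det ≠ 0 →
        D ≤ orbitMultiplicity ℂ (paddedPerFormLex ℂ n (n + j)) (n + j)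
          (partitionWeightLex (n + j) (rowLift μ j))

/-- **L2 — ISOBARIC INHERITANCE (the engine).** If inner highest-weight vectors `F₁ … F_D` of
weight `μ*` (`μ ⊢ nδ`, `≤ n²` parts) have a nonsingular UNTWISTED evaluation matrix on inner points
`A_l · per_n` that are `x_t`-isobaric (of any degrees `e₀ l`), then for EVERY padding `j`:
`D ≤ mult_{(μ♯(n+j))*} ℂ[Δ_{n+j}(X₀₀^j per_n)]`.  One inner certificate, all of the tail.
[this idea] -/
def IsobaricInheritance : Prop :=
  ∀ (n j δ : ℕ) [NeZero n] [NeZero (n + j)] (μ : Nat.Partition (n * δ)), μ.parts.card ≤ n * n →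
    ∀ (D : ℕ) (F : Fin D → MvPolynomial (DegIdx (MatIdx n) n) ℂ),
      (∀ i, F i ∈ highestWeightSpace (coordRep (MatIdx n) ℂ n) (partitionWeightLex n μ)) →
      ∀ (A : Fin D → Matrix (MatIdx n) (MatIdx n) ℂ) (e₀ : Fin D → ℕ),
        (∀ l, IsTopIsobaric n (e₀ l) (linSubst (MatIdx n) ℂ (A l) (paddedPerFormLex ℂ n n))) →
        (Matrix.of fun i l : Fin D => MvPolynomial.aeval
            (fun e : DegIdx (MatIdx n) n =>
              MvPolynomial.coeff e.1 (linSubst (MatIdx n) ℂ (A l) (paddedPerFormLex ℂ n n)))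
            (F i)).det ≠ 0 →
        D ≤ orbitMultiplicity ℂ (paddedPerFormLex ℂ n (n + j)) (n + j)
          (partitionWeightLex (n + j) (rowLift μ j))

/-- **L1 holds** (sorry-free): on an isobaric form the twisted coefficient vector is the scalar
multiple `((e₀+j).descFactorial j) • (coefficient vector)`, and a form of degree `δ` scales by the
`δ`-th power (`Literature.RingTheory.MvPolynomial.eval_smul_of_isHomogeneous`). [this idea] -/
theorem isobaricTwistScalar_holds : IsobaricTwistScalar := by
  intro n j δ e₀ _ F hF h hiso
  have hfun : (fun e : DegIdx (MatIdx n) n =>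
        (((e.1 (topMatIdx n) + j).descFactorial j : ℕ) : ℂ) * MvPolynomial.coeff e.1 h) =
      (((e₀ + j).descFactorial j : ℕ) : ℂ) • (fun e : DegIdx (MatIdx n) n => MvPolynomial.coeff e.1 h) := by
    funext e
    simp only [Pi.smul_apply, smul_eq_mul]
    by_cases hc : MvPolynomial.coeff e.1 h = 0
    · simp [hc]
    · rw [hiso e.1 (MvPolynomial.mem_support_iff.mpr hc)]
  rw [hfun]
  simp only [MvPolynomial.aeval_eq_eval]
  exact Literature.RingTheory.MvPolynomial.eval_smul_of_isHomogeneous hF _ _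

/-- **Glue (sorry-free): L1 + twisted inheritance ⇒ isobaric inheritance.**  The twisted matrix is
the untwisted one with column `l` scaled by `((e₀ l + j).descFactorial j)^δ ≠ 0`
(`Matrix.det_mul_row`). [this idea] -/
theorem isobaricInheritance_of (h1 : IsobaricTwistScalar) (h2 : TwistedInheritance) :
    IsobaricInheritance := by
  intro n j δ _ _ μ hμ D F hF A e₀ hiso hdet
  have hhom : ∀ i, (F i).IsHomogeneous δ := fun i =>
    isHomogeneous_of_mem_highestWeightSpace (NeZero.ne n) (hF i) (size_partitionWeightLex' μ hμ)
  refine h2 n j δ μ hμ D F hF A ?_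
  have key : (Matrix.of fun i l : Fin D => MvPolynomial.aeval
            (fun e : DegIdx (MatIdx n) n =>
              (((e.1 (topMatIdx n) + j).descFactorial j : ℕ) : ℂ) *
                MvPolynomial.coeff e.1 (linSubst (MatIdx n) ℂ (A l) (paddedPerFormLex ℂ n n)))
            (F i)) =
      Matrix.of fun i l : Fin D => ((((e₀ l + j).descFactorial j : ℕ) : ℂ) ^ δ) *
        MvPolynomial.aeval (fun e : DegIdx (MatIdx n) n =>
          MvPolynomial.coeff e.1 (linSubst (MatIdx n) ℂ (A l) (paddedPerFormLex ℂ n n))) (F i) := by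
    ext i l
    simp only [Matrix.of_apply]
    exact h1 n j δ (e₀ l) (F i) (hhom i) _ (hiso l)
  rw [key, Matrix.det_mul_row]
  refine mul_ne_zero ?_ hdet
  refine Finset.prod_ne_zero_iff.mpr fun l _ => pow_ne_zero _ ?_
  have : (e₀ l + j).descFactorial j ≠ 0 := by
    rw [Ne, Nat.descFactorial_eq_zero_iff_lt]
    omega
  exact_mod_cast this

/-- **The engine from the siege stub alone**: `TwistedInheritance → IsobaricInheritance`. [this idea] -/
theorem isobaricInheritance_of_twisted (h2 : TwistedInheritance) : IsobaricInheritance :=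
  isobaricInheritance_of isobaricTwistScalar_holds h2

end

end Summit.ValiantsHypothesis.ValiantsHypothesis.Cruxes.TailFlip.IsobaricAnchors
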